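import Summits.CriticalPhenomena.PercolationContinuityZ3.Theorems.PercNearOneGluingNoHeavyLowerTailSahiColouredMSTables
import Mathlib.Tactic
import HarnessLib
import HarnessLib.Audit.Tags

/-!
# `NoHeavyLowerTail` (crux stmt-CriticalPhenomena-4575), master-family line P1 (gen 28):
# coloured Marica–Schönheim for two colours, part 2/3 — configurations, the support identity, the lifting inclusions

Support file (seat `prim-masterthm-p1`, gen 28; `--supports stmt-CriticalPhenomena-4575`).  Definitions: `supp` (support of a configuration
`t : Finset α → Ty` inside `2^u`), `pairCred`, `credits` (credited sets), the slice configurations `proj₂`, `proj₁`, and the lift families `liftOne`,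
`liftTwo`.  Results: `#supp (insert a u) t = #supp u (proj₂ a t) + #supp u (proj₁ a t)`, `#credits (insert a u) t = #liftOne + #liftTwo`, and the two
LIFTING INCLUSIONS `credits u (proj₂ a t) ⊆ liftOne a u t`, `credits u (proj₁ a t) ⊆ liftTwo a u t` (every credit of the single-lift projection is a credit
at `x` or at `insert a x`; every credit of the double-lift projection is a credit at both) — the set algebra is
`(z+εa) ∖ (w+φa) = (z∖w) + [ε ∧ ¬φ]a`, `∩ ↦ ε∧φ`, `∪ ↦ ε∨φ`, and the finite content is part 1's `decide`d lemmas.  No `sorry`, standard axioms.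
Memo `run/shared/lean/prim/prim-masterthm/FROM-prim-masterthm-p1-g28-STRONG-DAYKIN.md` §9–§10 (typed Marica–Schönheim induction; the six-letter
system and the projection maps were found by the closure search `code-g28/typed/` and are checked here by the kernel). [this work]
-/

namespace Summit.CriticalPhenomena.PercolationContinuityZ3.Theorems.SahiColouredMS

open Finset
open scoped FinsetFamily
open Ty

/-! ### 3. Configurations, support, credits -/

variable {α : Type*} [DecidableEq α]

/-- The support of a configuration inside `2^u`. [this work] -/
def supp (u : Finset α) (t : Finset α → Ty) : Finset (Finset α) := u.powerset.filter fun s => pres (t s) = true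

/-- The credits of one ordered pair of points. [this work] -/
def pairCred (t : Finset α → Ty) (z w : Finset α) : Finset (Finset α) :=
  (if dT (t z) (t w) = true then {z \ w} else ∅) ∪ ((if mT (t z) (t w) = true then {z ∩ w} else ∅) ∪
    (if jT (t z) (t w) = true then {z ∪ w} else ∅))

/-- All credits of a configuration inside `2^u`: pair credits and self credits. [this work] -/
def credits (u : Finset α) (t : Finset α → Ty) : Finset (Finset α) :=
  ((supp u t ×ˢ supp u t).biUnion fun p => pairCred t p.1 p.2) ∪ (supp u t).filter fun z => sT (t z) = true

omit [DecidableEq α] in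
/-- Membership in the support. [this work] -/
theorem mem_supp {u : Finset α} {t : Finset α → Ty} {s : Finset α} : s ∈ supp u t ↔ s ⊆ u ∧ pres (t s) = true := by
  simp [supp]

/-- A credited difference. [this work] -/
theorem sdiff_mem_credits {u : Finset α} {t : Finset α → Ty} {z w : Finset α} (hz : z ∈ supp u t) (hw : w ∈ supp u t)
    (h : dT (t z) (t w) = true) : z \ w ∈ credits u t := by
  refine mem_union.2 (Or.inl (mem_biUnion.2 ⟨(z, w), mem_product.2 ⟨hz, hw⟩, ?_⟩))
  simp [pairCred, h]

/-- A credited intersection. [this work] -/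
theorem inter_mem_credits {u : Finset α} {t : Finset α → Ty} {z w : Finset α} (hz : z ∈ supp u t) (hw : w ∈ supp u t)
    (h : mT (t z) (t w) = true) : z ∩ w ∈ credits u t := by
  refine mem_union.2 (Or.inl (mem_biUnion.2 ⟨(z, w), mem_product.2 ⟨hz, hw⟩, ?_⟩))
  simp [pairCred, h]

/-- A credited union. [this work] -/
theorem union_mem_credits {u : Finset α} {t : Finset α → Ty} {z w : Finset α} (hz : z ∈ supp u t) (hw : w ∈ supp u t)
    (h : jT (t z) (t w) = true) : z ∪ w ∈ credits u t := by
  refine mem_union.2 (Or.inl (mem_biUnion.2 ⟨(z, w), mem_product.2 ⟨hz, hw⟩, ?_⟩))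
  simp [pairCred, h]

/-- A self credit. [this work] -/
theorem self_mem_credits {u : Finset α} {t : Finset α → Ty} {z : Finset α} (hz : z ∈ supp u t) (h : sT (t z) = true) :
    z ∈ credits u t :=
  mem_union.2 (Or.inr (mem_filter.2 ⟨hz, h⟩))

/-- Every credit is the credit of a pair with a true table entry, or a self credit. [this work] -/
theorem mem_credits_cases {u : Finset α} {t : Finset α → Ty} {x : Finset α} (hx : x ∈ credits u t) :
    (∃ z ∈ supp u t, ∃ w ∈ supp u t, (dT (t z) (t w) = true ∧ x = z \ w) ∨ (mT (t z) (t w) = true ∧ x = z ∩ w) ∨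
      (jT (t z) (t w) = true ∧ x = z ∪ w)) ∨ (x ∈ supp u t ∧ sT (t x) = true) := by
  rcases mem_union.1 hx with hx | hx
  · left
    obtain ⟨⟨z, w⟩, hp, hmem⟩ := mem_biUnion.1 hx
    obtain ⟨hz, hw⟩ := mem_product.1 hp
    refine ⟨z, hz, w, hw, ?_⟩
    simp only [pairCred, mem_union] at hmem
    rcases hmem with h | h | h
    · by_cases hd : dT (t z) (t w) = true
      · simp [hd] at h; exact Or.inl ⟨hd, h⟩
      · simp [hd] at h
    · by_cases hd : mT (t z) (t w) = true
      · simp [hd] at h; exact Or.inr (Or.inl ⟨hd, h⟩)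
      · simp [hd] at h
    · by_cases hd : jT (t z) (t w) = true
      · simp [hd] at h; exact Or.inr (Or.inr ⟨hd, h⟩)
      · simp [hd] at h
  · right
    exact mem_filter.1 hx

/-- Credits lie inside `2^u`. [this work] -/
theorem subset_of_mem_credits {u : Finset α} {t : Finset α → Ty} {x : Finset α} (hx : x ∈ credits u t) : x ⊆ u := by
  rcases mem_credits_cases hx with ⟨z, hz, w, hw, h⟩ | ⟨hxs, _⟩
  · have hzu := (mem_supp.1 hz).1
    have hwu := (mem_supp.1 hw).1
    rcases h with ⟨_, rfl⟩ | ⟨_, rfl⟩ | ⟨_, rfl⟩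
    · exact sdiff_subset.trans hzu
    · exact inter_subset_left.trans hzu
    · exact union_subset hzu hwu
  · exact (mem_supp.1 hxs).1

/-! ### 4. The slice configurations and the counting identity for the support -/

section Step

variable {a : α} {u : Finset α} (hu : a ∉ u) (t : Finset α → Ty)

/-- The single-lift projected configuration. [this work] -/
def proj₂ (a : α) (t : Finset α → Ty) : Finset α → Ty := fun s => h₂ (t s) (t (insert a s))

/-- The double-lift projected configuration. [this work] -/
def proj₁ (a : α) (t : Finset α → Ty) : Finset α → Ty := fun s => h₁ (t s) (t (insert a s))

include hu in
/-- `#supp (insert a u) t = #supp u (proj₂) + #supp u (proj₁)`. [this work] -/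
theorem card_supp_insert :
    #(supp (insert a u) t) = #(supp u (proj₂ a t)) + #(supp u (proj₁ a t)) := by
  -- split supp (insert a u) t by membership of a
  set S := supp (insert a u) t
  set S₀ := S.filter fun s => a ∉ s
  set S₁ := S.filter fun s => a ∈ s
  have hS : #S = #S₀ + #S₁ := by
    rw [← card_filter_add_card_filter_not (fun s => a ∉ s)]
    congr 1
    refine congrArg card (filter_congr fun s _ => ?_)
    simp
  -- S₀ = {s ⊆ u : pres (t s)} ; S₁ ≃ {s ⊆ u : pres (t (insert a s))} via erase
  set L := u.powerset.filter fun s => pres (t s) = true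
  set H := u.powerset.filter fun s => pres (t (insert a s)) = true
  have hS₀ : S₀ = L := by
    ext s
    simp only [S₀, S, L, supp, mem_filter, mem_powerset]
    constructor
    · rintro ⟨⟨hs, hp⟩, has⟩
      exact ⟨fun x hx => (mem_insert.1 (hs hx)).resolve_left fun h => has (h ▸ hx), hp⟩
    · rintro ⟨hs, hp⟩
      exact ⟨⟨hs.trans (subset_insert a u), hp⟩, fun h => hu (hs h)⟩
  have hS₁ : #S₁ = #H := by
    refine card_bij (fun s _ => s.erase a) ?_ ?_ ?_
    · intro s hs
      simp only [S₁, S, supp, mem_filter, mem_powerset] at hs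
      obtain ⟨⟨hs, hp⟩, has⟩ := hs
      refine mem_filter.2 ⟨mem_powerset.2 ?_, ?_⟩
      · intro x hx
        rcases mem_erase.1 hx with ⟨hxa, hxs⟩
        exact (mem_insert.1 (hs hxs)).resolve_left hxa
      · rwa [insert_erase has]
    · intro s hs s' hs' h
      simp only [S₁, S, mem_filter] at hs hs'
      rw [← insert_erase hs.2, ← insert_erase hs'.2, h]
    · intro s' hs'
      obtain ⟨hs'u, hp⟩ := mem_filter.1 hs'
      have has' : a ∉ s' := fun h => hu (mem_powerset.1 hs'u h)
      refine ⟨insert a s', ?_, erase_insert has'⟩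
      simp only [S₁, S, supp, mem_filter, mem_powerset]
      exact ⟨⟨insert_subset_insert a (mem_powerset.1 hs'u), hp⟩, mem_insert_self a s'⟩
  -- supp u proj₂ = L ∪ H, supp u proj₁ = L ∩ H
  have h2 : supp u (proj₂ a t) = L ∪ H := by
    ext s
    simp only [supp, proj₂, mem_filter, mem_union, mem_powerset, L, H, pres_h₂, Bool.or_eq_true]
    tauto
  have h1 : supp u (proj₁ a t) = L ∩ H := by
    ext s
    simp only [supp, proj₁, mem_filter, mem_inter, mem_powerset, L, H, pres_h₁, Bool.and_eq_true]
    tauto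
  rw [hS, hS₀, hS₁, h2, h1]
  exact (card_union_add_card_inter L H).symm

/-! ### 5. The lifting inclusions -/

/-- The set of `x ⊆ u` with `x` or `insert a x` credited ("single lifts"). [this work] -/
def liftOne (a : α) (u : Finset α) (t : Finset α → Ty) : Finset (Finset α) :=
  u.powerset.filter fun x => x ∈ credits (insert a u) t ∨ insert a x ∈ credits (insert a u) t

/-- The set of `x ⊆ u` with both `x` and `insert a x` credited ("double lifts"). [this work] -/
def liftTwo (a : α) (u : Finset α) (t : Finset α → Ty) : Finset (Finset α) :=
  u.powerset.filter fun x => x ∈ credits (insert a u) t ∧ insert a x ∈ credits (insert a u) t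

include hu in
/-- `#credits (insert a u) t = #liftOne + #liftTwo`. [this work] -/
theorem card_credits_insert : #(credits (insert a u) t) = #(liftOne a u t) + #(liftTwo a u t) := by
  set C := credits (insert a u) t
  set C₀ := C.filter fun s => a ∉ s
  set C₁ := C.filter fun s => a ∈ s
  have hC : #C = #C₀ + #C₁ := by
    rw [← card_filter_add_card_filter_not (fun s => a ∉ s)]
    congr 1
    refine congrArg card (filter_congr fun s _ => ?_)
    simp
  set L := u.powerset.filter fun x => x ∈ C
  set H := u.powerset.filter fun x => insert a x ∈ C
  have hC₀ : C₀ = L := by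
    ext s
    simp only [C₀, L, mem_filter, mem_powerset]
    constructor
    · rintro ⟨hs, has⟩
      exact ⟨fun x hx => (mem_insert.1 (subset_of_mem_credits hs hx)).resolve_left fun h => has (h ▸ hx), hs⟩
    · rintro ⟨hs, hC⟩
      exact ⟨hC, fun h => hu (hs h)⟩
  have hC₁ : #C₁ = #H := by
    refine card_bij (fun s _ => s.erase a) ?_ ?_ ?_
    · intro s hs
      obtain ⟨hsC, has⟩ := mem_filter.1 hs
      refine mem_filter.2 ⟨mem_powerset.2 ?_, ?_⟩
      · intro x hx
        rcases mem_erase.1 hx with ⟨hxa, hxs⟩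
        exact (mem_insert.1 (subset_of_mem_credits hsC hxs)).resolve_left hxa
      · rwa [insert_erase has]
    · intro s hs s' hs' h
      rw [← insert_erase (mem_filter.1 hs).2, ← insert_erase (mem_filter.1 hs').2, h]
    · intro s' hs'
      obtain ⟨hs'u, hC'⟩ := mem_filter.1 hs'
      have has' : a ∉ s' := fun h => hu (mem_powerset.1 hs'u h)
      exact ⟨insert a s', mem_filter.2 ⟨hC', mem_insert_self a s'⟩, erase_insert has'⟩
  have h1 : liftOne a u t = L ∪ H := by
    ext x; simp only [liftOne, L, H, mem_filter, mem_union, mem_powerset]; tauto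
  have h2 : liftTwo a u t = L ∩ H := by
    ext x; simp only [liftTwo, L, H, mem_filter, mem_inter, mem_powerset]; tauto
  rw [hC, hC₀, hC₁, h1, h2]
  exact (card_union_add_card_inter L H).symm

include hu in
/-- Set algebra of the lifts (with `a ∉ z, w`). [folklore] -/
private theorem lift_algebra {z w : Finset α} (hz : z ⊆ u) (hw : w ⊆ u) :
    z \ insert a w = z \ w ∧ insert a z \ insert a w = z \ w ∧ insert a z \ w = insert a (z \ w) ∧
    z ∩ insert a w = z ∩ w ∧ insert a z ∩ w = z ∩ w ∧ insert a z ∩ insert a w = insert a (z ∩ w) ∧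
    z ∪ insert a w = insert a (z ∪ w) ∧ insert a z ∪ w = insert a (z ∪ w) ∧ insert a z ∪ insert a w = insert a (z ∪ w) := by
  have haz : a ∉ z := fun h => hu (hz h)
  have haw : a ∉ w := fun h => hu (hw h)
  refine ⟨?_, ?_, ?_, ?_, ?_, ?_, ?_, ?_, ?_⟩ <;> ext x <;> simp only [mem_sdiff, mem_insert, mem_inter, mem_union] <;>
    constructor <;> intro h <;> (try tauto) <;> aesop

include hu in
/-- **Single lifts**: every credit of `proj₂` is a credit of `t` at `x` or at `insert a x`. [this work] -/
theorem credits_proj₂_subset : credits u (proj₂ a t) ⊆ liftOne a u t := by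
  intro x hx
  have hxu : x ⊆ u := subset_of_mem_credits hx
  refine mem_filter.2 ⟨mem_powerset.2 hxu, ?_⟩
  rcases mem_credits_cases hx with ⟨z, hz, w, hw, h⟩ | ⟨hxs, hsx⟩
  · have hzu := (mem_supp.1 hz).1
    have hwu := (mem_supp.1 hw).1
    obtain ⟨e1, e2, e3, e4, e5, e6, e7, e8, e9⟩ := lift_algebra hu (z := z) (w := w) hzu hwu
    -- supp membership of the four lifts when their type is present
    have sz : pres (t z) = true → z ∈ supp (insert a u) t := fun hp => mem_supp.2 ⟨hzu.trans (subset_insert a u), hp⟩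
    have sz' : pres (t (insert a z)) = true → insert a z ∈ supp (insert a u) t := fun hp => mem_supp.2 ⟨insert_subset_insert a hzu, hp⟩
    have sw : pres (t w) = true → w ∈ supp (insert a u) t := fun hp => mem_supp.2 ⟨hwu.trans (subset_insert a u), hp⟩
    have sw' : pres (t (insert a w)) = true → insert a w ∈ supp (insert a u) t := fun hp => mem_supp.2 ⟨insert_subset_insert a hwu, hp⟩
    rcases h with ⟨hd, rfl⟩ | ⟨hm, rfl⟩ | ⟨hj, rfl⟩
    · rcases liftD₂ _ _ _ _ hd with h | h | h | h
      · have := pres_of_table _ _ (Or.inl h)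
        exact Or.inl (sdiff_mem_credits (sz this.1) (sw this.2) h)
      · have := pres_of_table _ _ (Or.inl h)
        have hc := sdiff_mem_credits (sz this.1) (sw' this.2) h
        rw [e1] at hc; exact Or.inl hc
      · have := pres_of_table _ _ (Or.inl h)
        have hc := sdiff_mem_credits (sz' this.1) (sw this.2) h
        rw [e3] at hc; exact Or.inr hc
      · have := pres_of_table _ _ (Or.inl h)
        have hc := sdiff_mem_credits (sz' this.1) (sw' this.2) h
        rw [e2] at hc; exact Or.inl hc
    · rcases liftM₂ _ _ _ _ hm with h | h | h | h
      · have := pres_of_table _ _ (Or.inr (Or.inl h))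
        exact Or.inl (inter_mem_credits (sz this.1) (sw this.2) h)
      · have := pres_of_table _ _ (Or.inr (Or.inl h))
        have hc := inter_mem_credits (sz this.1) (sw' this.2) h
        rw [e4] at hc; exact Or.inl hc
      · have := pres_of_table _ _ (Or.inr (Or.inl h))
        have hc := inter_mem_credits (sz' this.1) (sw this.2) h
        rw [e5] at hc; exact Or.inl hc
      · have := pres_of_table _ _ (Or.inr (Or.inl h))
        have hc := inter_mem_credits (sz' this.1) (sw' this.2) h
        rw [e6] at hc; exact Or.inr hc
    · rcases liftJ₂ _ _ _ _ hj with h | h | h | h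
      · have := pres_of_table _ _ (Or.inr (Or.inr h))
        exact Or.inl (union_mem_credits (sz this.1) (sw this.2) h)
      · have := pres_of_table _ _ (Or.inr (Or.inr h))
        have hc := union_mem_credits (sz this.1) (sw' this.2) h
        rw [e7] at hc; exact Or.inr hc
      · have := pres_of_table _ _ (Or.inr (Or.inr h))
        have hc := union_mem_credits (sz' this.1) (sw this.2) h
        rw [e8] at hc; exact Or.inr hc
      · have := pres_of_table _ _ (Or.inr (Or.inr h))
        have hc := union_mem_credits (sz' this.1) (sw' this.2) h
        rw [e9] at hc; exact Or.inr hc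
  · -- self credit of proj₂ at x
    have sx : pres (t x) = true → x ∈ supp (insert a u) t := fun hp => mem_supp.2 ⟨hxu.trans (subset_insert a u), hp⟩
    have sx' : pres (t (insert a x)) = true → insert a x ∈ supp (insert a u) t := fun hp => mem_supp.2 ⟨insert_subset_insert a hxu, hp⟩
    have hax : a ∉ x := fun h => hu (hxu h)
    have i1 : x ∩ insert a x = x := by ext y; simp only [mem_inter, mem_insert]; tauto
    have i2 : insert a x ∩ x = x := by ext y; simp only [mem_inter, mem_insert]; tauto
    have u1 : x ∪ insert a x = insert a x := by ext y; simp only [mem_union, mem_insert]; tauto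
    have u2 : insert a x ∪ x = insert a x := by ext y; simp only [mem_union, mem_insert]; tauto
    rcases liftS₂ _ _ hsx with h | h | h | h | h | h
    · exact Or.inl (self_mem_credits (sx (pres_of_sT _ h)) h)
    · exact Or.inr (self_mem_credits (sx' (pres_of_sT _ h)) h)
    · have := pres_of_table _ _ (Or.inr (Or.inl h))
      have hc := inter_mem_credits (sx this.1) (sx' this.2) h
      rw [i1] at hc; exact Or.inl hc
    · have := pres_of_table _ _ (Or.inr (Or.inl h))
      have hc := inter_mem_credits (sx' this.1) (sx this.2) h
      rw [i2] at hc; exact Or.inl hc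
    · have := pres_of_table _ _ (Or.inr (Or.inr h))
      have hc := union_mem_credits (sx this.1) (sx' this.2) h
      rw [u1] at hc; exact Or.inr hc
    · have := pres_of_table _ _ (Or.inr (Or.inr h))
      have hc := union_mem_credits (sx' this.1) (sx this.2) h
      rw [u2] at hc; exact Or.inr hc

include hu in
/-- **Double lifts**: every credit of `proj₁` is a credit of `t` at `x` AND at `insert a x`. [this work] -/
theorem credits_proj₁_subset : credits u (proj₁ a t) ⊆ liftTwo a u t := by
  intro x hx
  have hxu : x ⊆ u := subset_of_mem_credits hx
  refine mem_filter.2 ⟨mem_powerset.2 hxu, ?_⟩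
  rcases mem_credits_cases hx with ⟨z, hz, w, hw, h⟩ | ⟨hxs, hsx⟩
  · have hzu := (mem_supp.1 hz).1
    have hwu := (mem_supp.1 hw).1
    obtain ⟨e1, e2, e3, e4, e5, e6, e7, e8, e9⟩ := lift_algebra hu (z := z) (w := w) hzu hwu
    have sz : pres (t z) = true → z ∈ supp (insert a u) t := fun hp => mem_supp.2 ⟨hzu.trans (subset_insert a u), hp⟩
    have sz' : pres (t (insert a z)) = true → insert a z ∈ supp (insert a u) t := fun hp => mem_supp.2 ⟨insert_subset_insert a hzu, hp⟩
    have sw : pres (t w) = true → w ∈ supp (insert a u) t := fun hp => mem_supp.2 ⟨hwu.trans (subset_insert a u), hp⟩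
    have sw' : pres (t (insert a w)) = true → insert a w ∈ supp (insert a u) t := fun hp => mem_supp.2 ⟨insert_subset_insert a hwu, hp⟩
    rcases h with ⟨hd, rfl⟩ | ⟨hm, rfl⟩ | ⟨hj, rfl⟩
    · obtain ⟨h0, h1⟩ := liftD₁ _ _ _ _ hd
      refine ⟨?_, ?_⟩
      · rcases h0 with h | h | h
        · have := pres_of_table _ _ (Or.inl h); exact sdiff_mem_credits (sz this.1) (sw this.2) h
        · have := pres_of_table _ _ (Or.inl h)
          have hc := sdiff_mem_credits (sz this.1) (sw' this.2) h; rwa [e1] at hc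
        · have := pres_of_table _ _ (Or.inl h)
          have hc := sdiff_mem_credits (sz' this.1) (sw' this.2) h; rwa [e2] at hc
      · have := pres_of_table _ _ (Or.inl h1)
        have hc := sdiff_mem_credits (sz' this.1) (sw this.2) h1; rwa [e3] at hc
    · obtain ⟨h0, h1⟩ := liftM₁ _ _ _ _ hm
      refine ⟨?_, ?_⟩
      · rcases h0 with h | h | h
        · have := pres_of_table _ _ (Or.inr (Or.inl h)); exact inter_mem_credits (sz this.1) (sw this.2) h
        · have := pres_of_table _ _ (Or.inr (Or.inl h))
          have hc := inter_mem_credits (sz this.1) (sw' this.2) h; rwa [e4] at hc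
        · have := pres_of_table _ _ (Or.inr (Or.inl h))
          have hc := inter_mem_credits (sz' this.1) (sw this.2) h; rwa [e5] at hc
      · have := pres_of_table _ _ (Or.inr (Or.inl h1))
        have hc := inter_mem_credits (sz' this.1) (sw' this.2) h1; rwa [e6] at hc
    · obtain ⟨h0, h1⟩ := liftJ₁ _ _ _ _ hj
      refine ⟨?_, ?_⟩
      · have := pres_of_table _ _ (Or.inr (Or.inr h0)); exact union_mem_credits (sz this.1) (sw this.2) h0
      · rcases h1 with h | h | h
        · have := pres_of_table _ _ (Or.inr (Or.inr h))
          have hc := union_mem_credits (sz this.1) (sw' this.2) h; rwa [e7] at hc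
        · have := pres_of_table _ _ (Or.inr (Or.inr h))
          have hc := union_mem_credits (sz' this.1) (sw this.2) h; rwa [e8] at hc
        · have := pres_of_table _ _ (Or.inr (Or.inr h))
          have hc := union_mem_credits (sz' this.1) (sw' this.2) h; rwa [e9] at hc
  · have sx : pres (t x) = true → x ∈ supp (insert a u) t := fun hp => mem_supp.2 ⟨hxu.trans (subset_insert a u), hp⟩
    have sx' : pres (t (insert a x)) = true → insert a x ∈ supp (insert a u) t := fun hp => mem_supp.2 ⟨insert_subset_insert a hxu, hp⟩
    have hax : a ∉ x := fun h => hu (hxu h)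
    have i1 : x ∩ insert a x = x := by ext y; simp only [mem_inter, mem_insert]; tauto
    have i2 : insert a x ∩ x = x := by ext y; simp only [mem_inter, mem_insert]; tauto
    have u1 : x ∪ insert a x = insert a x := by ext y; simp only [mem_union, mem_insert]; tauto
    have u2 : insert a x ∪ x = insert a x := by ext y; simp only [mem_union, mem_insert]; tauto
    obtain ⟨h0, h1⟩ := liftS₁ _ _ hsx
    refine ⟨?_, ?_⟩
    · rcases h0 with h | h | h
      · exact self_mem_credits (sx (pres_of_sT _ h)) h
      · have := pres_of_table _ _ (Or.inr (Or.inl h))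
        have hc := inter_mem_credits (sx this.1) (sx' this.2) h; rwa [i1] at hc
      · have := pres_of_table _ _ (Or.inr (Or.inl h))
        have hc := inter_mem_credits (sx' this.1) (sx this.2) h; rwa [i2] at hc
    · rcases h1 with h | h | h
      · exact self_mem_credits (sx' (pres_of_sT _ h)) h
      · have := pres_of_table _ _ (Or.inr (Or.inr h))
        have hc := union_mem_credits (sx this.1) (sx' this.2) h; rwa [u1] at hc
      · have := pres_of_table _ _ (Or.inr (Or.inr h))
        have hc := union_mem_credits (sx' this.1) (sx this.2) h; rwa [u2] at hc

end Step

end Summit.CriticalPhenomena.PercolationContinuityZ3.Theorems.SahiColouredMS
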